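import Summits.QuantumFields.BalabanUV.Beta.FP.SliceProjectorAliasSum

/-!
# `BalabanUV.Beta.FP.SliceProjectorBlochChart` — road «FP» (binder row D1), organisation γ, row **GAMMA-3 (d)** part 1∕4: THE BLOCH BOOKKEEPING
# FOR `N`-PERIODIC KERNELS ON `ℤ^D` — root-of-unity sums and CHARACTER ORTHOGONALITY over the alias index, the characters at alias momenta
# (a coarse shift `N•X` is invisible to the alias index), the lattice-kernel SHIFT RULE `latticeKernel (G·cphase Z) W = latticeKernel G (W+Z)`,
# and the BLOCK CHART `ℤ^D ≃ ℤ^D × {0,…,N−1}^D` with the block regrouping of absolutely convergent complex lattice sums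

HONEST FRAMING (cell contract, verbatim): «discharging `BetaPertH` makes Bałaban's UV stability UNCONDITIONAL — a real constructive-QFT
result; it is NOT the continuum limit and NOT the Clay problem.»  HONEST DEPENDENCY (verbatim): «continuum YM on T⁴ ⇐ BetaPertH ∧ nine
spine estimates (0/9 proved); BetaPertH ⇐ (D1) ∧ (D4) ∧ CAP+tail; G-an2-4 gates asym, D1 and NE2/3/4.»  THIS MODULE DISCHARGES NOTHING of
D1 ∕ BetaPertH: [folklore] finite Fourier analysis (`IsPrimitiveRoot` geometric sums, `Fintype.prod_sum`), Euclidean division on `ℤ^D`, and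
`Equiv.tsum_eq`∕`Summable.tsum_prod'`; [our object] data defs `finSite`, `blkN`, `locN`, `blockEquivN` (block label ∕ offset ∕ chart for a general
side `N ≥ 1`, blocks `N•X + {0,…,N−1}^D` = `AffineAveraging.blockSum`'s); no `def … : Prop`; nothing is cited; 0 sorry.  It is the engine kept INSIDE
row GAMMA-3 (d) (R-FP-33 (c) clause, named in INTENT l.27194: the road instance of `(1−Π)_N` cannot be composed without it).  NOT summit progress;
NOT hbook, NOT D1, NOT BetaPertH, NOT continuum, NOT Clay.

ABSOLUTE RULE (cell, verbatim): «No internally-minted statement may enter as a cited fact. Every hypothesis is either kernel-proved in this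
package or a verbatim quotation of a PUBLISHED theorem with page reference. The manuscript(s) under audit are NOT citable for their own
disputed steps — they are the thing under adjudication; programme-internal (2001/route/tribunal) claims are never citable.»

CONTENT (`D = d+1`, `N ≥ 1` via `[NeZero N]`):
* §1 **`sum_rootChar`**∕`sum_rootChar'` (`Σ_{t<N} e^{2πi·m·t∕N} = N·𝟙[N ∣ m]`), **`sum_alias_char`** (`Σ_l Π_μ e^{i(2πl_μ∕N)z_μ} = N^D·𝟙[N ∣ z]`).
* §2 `cphase_neg_mul_self`, **`cphase_zsmul_aliasPt`** (`cphase (N•X) (k_l) = cphase X k`), `cphase_chart_aliasPt`,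
  `cphase_neg_chart_aliasPt`, `cphase_aliasPt_eq`, **`sum_cphase_aliasPt`** (`Σ_l cphase z (k_l)`: `N^D·e^{ik·z∕N}` if `N ∣ z`, else `0`),
  `sum_cphase_aliasPt_zsmul`, **`latticeKernel_mul_cphase`** (shift rule), `latticeKernel_mul_cphase_zero`.
* §3 `finSite`, `blkN`, `locN`, `chart_blkN_locN` (`N•blk x + loc x = x`), `blkN_chart`, `locN_chart`, **`blockEquivN`**, **`tsum_blocksN`**
  (`Σ'_x f x = Σ'_X Σ_c f (N•X + c)` for summable complex `f`), `finSite_eq_toSite`.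
Unit `b2b-balaban-beta-d1-formalise-leaf-06` (gen 9), road «FP» OWNER GO «THIS SHAPE» journal l.27277 (1) on INTENT l.27194; organisation γ (R-FP-25), row GAMMA-3 (d), under R-FP-33 (b)(c).
-/

noncomputable section

namespace Summit.QuantumFields.BalabanUV.Beta.FP.SliceProjectorBlochChart

open Complex Finset MeasureTheory
open scoped BigOperators Real
open Literature.MathematicalPhysics.QuantumFieldTheory.Balaban1983to89
open Literature.MathematicalPhysics.QuantumFieldTheory.Balaban1983to89.Beta.AffineAveraging (Site box toSite blockSum unitVec)
open B4Strip (ofRealVec)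
open B4ContourShift (BZ phase integrand fourierBox latticeKernel)
open Beta.FibreInverseDecay (cphase)
open Summit.QuantumFields.BalabanUV.Beta.GAN24.FibreSymbols (pw pw_add)
open Summit.QuantumFields.BalabanUV.Beta.GAN24.AliasDecimate (aliasPt)
open Summit.QuantumFields.BalabanUV.Beta.FP.CoarseCovarianceStripAliasWeights (aliasPt_apply')

variable {d : ℕ}

/-! ## §1 Root-of-unity sums (character orthogonality in one and in `D = d+1` dimensions) -/

/-- [folklore] **ROOT-OF-UNITY SUM**: `Σ_{t<N} e^{2πi·m·t/N} = N` if `N ∣ m`, `= 0` otherwise (`m ∈ ℤ`, `N ≥ 1`). -/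
theorem sum_rootChar (N : ℕ) [NeZero N] (m : ℤ) :
    ∑ t : Fin N, cexp (2 * π * I * (m : ℂ) * ((t : ℕ) : ℂ) / N) = if (N : ℤ) ∣ m then (N : ℂ) else 0 := by
  have hN : N ≠ 0 := NeZero.ne N
  set ζ : ℂ := cexp (2 * π * I / N) with hζdef
  have hζ : IsPrimitiveRoot ζ N := Complex.isPrimitiveRoot_exp N hN
  have hterm : ∀ t : Fin N, cexp (2 * π * I * (m : ℂ) * ((t : ℕ) : ℂ) / N) = (ζ ^ m) ^ (t : ℕ) := by
    intro t
    rw [hζdef, ← Complex.exp_int_mul, ← Complex.exp_nat_mul]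
    congr 1; ring
  simp_rw [hterm]
  rw [Fin.sum_univ_eq_sum_range (fun t => (ζ ^ m) ^ t)]
  by_cases hdiv : (N : ℤ) ∣ m
  · rw [if_pos hdiv, (hζ.zpow_eq_one_iff_dvd m).mpr hdiv]
    simp
  · rw [if_neg hdiv]
    have hne : ζ ^ m ≠ 1 := fun h => hdiv ((hζ.zpow_eq_one_iff_dvd m).mp h)
    rw [geom_sum_eq hne, ← zpow_natCast, ← zpow_mul, mul_comm, zpow_mul, zpow_natCast, hζ.pow_eq_one, one_zpow, sub_self,
      zero_div]

/-- [folklore] the same sum written with the alias phase `(2π·t/N)·m`: `Σ_{t<N} e^{i·(2πt/N)·m}`. -/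
theorem sum_rootChar' (N : ℕ) [NeZero N] (m : ℤ) :
    ∑ t : Fin N, cexp (I * (2 * π * ((t : ℕ) : ℂ) / N) * (m : ℂ)) = if (N : ℤ) ∣ m then (N : ℂ) else 0 := by
  rw [← sum_rootChar N m]
  exact Finset.sum_congr rfl fun t _ => by congr 1; ring

/-- [folklore] **CHARACTER ORTHOGONALITY OVER THE ALIAS INDEX**: for `z ∈ ℤ^D`,
`Σ_{l ∈ {0..N−1}^D} Π_μ e^{i(2πl_μ/N)z_μ} = N^D` if `N ∣ z_μ` for every `μ`, `= 0` otherwise. -/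
theorem sum_alias_char (N : ℕ) [NeZero N] (z : Fin (d + 1) → ℤ) :
    ∑ l : Fin (d + 1) → Fin N, ∏ μ, cexp (I * (2 * π * ((l μ : ℕ) : ℂ) / N) * (z μ : ℂ))
      = if ∀ μ, (N : ℤ) ∣ z μ then ((N : ℂ) ^ (d + 1)) else 0 := by
  classical
  rw [← Fintype.prod_sum (fun μ (t : Fin N) => cexp (I * (2 * π * ((t : ℕ) : ℂ) / N) * (z μ : ℂ)))]
  simp_rw [sum_rootChar']
  by_cases h : ∀ μ, (N : ℤ) ∣ z μ
  · rw [if_pos h]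
    simp_rw [if_pos (h _)]
    simp
  · rw [if_neg h]
    obtain ⟨μ, hμ⟩ := not_forall.mp h
    exact Finset.prod_eq_zero (Finset.mem_univ μ) (if_neg hμ)

/-! ## §2 Bloch characters: the plane wave `cphase`, alias momenta, coarse shifts, and the lattice-kernel shift rule -/

/-! NOTE. Additivity `cphase (u + v) p = cphase u p · cphase v p` is `GAN24.FibreSymbols.pw_add p u v` read through the definitional
identity `pw p x = cphase x p`; it is used below in that form (the named restatement lives in `GAN24.CombesThomasFibreStep.cphase_add_eq_mul`,
outside this file's import cone). -/

/-- [folklore] `cphase (−u) p · cphase u p = 1`. -/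
theorem cphase_neg_mul_self (u : Fin (d + 1) → ℤ) (p : Fin (d + 1) → ℂ) : cphase (-u) p * cphase u p = 1 := by
  rw [← show cphase (-u + u) p = cphase (-u) p * cphase u p from pw_add p (-u) u, neg_add_cancel]
  unfold cphase
  simp

/-- [folklore] **A COARSE SHIFT IS INVISIBLE TO THE ALIAS INDEX**: `cphase (N•X) (k_l) = cphase X k` (`e^{i(k+2πl)·X} = e^{ik·X}` on `ℤ^D`). -/
theorem cphase_zsmul_aliasPt (N : ℕ) [NeZero N] (X : Fin (d + 1) → ℤ) (l : Fin (d + 1) → Fin N) (k : Fin (d + 1) → ℂ) :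
    cphase ((N : ℤ) • X) (aliasPt N l k) = cphase X k := by
  have hN : (N : ℂ) ≠ 0 := Nat.cast_ne_zero.mpr (NeZero.ne N)
  unfold cphase
  have hsum : ∑ μ, aliasPt N l k μ * ((((N : ℤ) • X) μ : ℤ) : ℂ)
      = (∑ μ, k μ * (X μ : ℂ)) + ((∑ μ, ((l μ : ℕ) : ℤ) * X μ : ℤ) : ℂ) * (2 * π) := by
    push_cast
    rw [Finset.sum_mul, ← Finset.sum_add_distrib]
    refine Finset.sum_congr rfl fun μ _ => ?_
    rw [aliasPt_apply', Pi.smul_apply, smul_eq_mul, Int.cast_mul, Int.cast_natCast]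
    field_simp
  rw [hsum, mul_add, Complex.exp_add]
  have h1 : cexp (I * (((∑ μ, ((l μ : ℕ) : ℤ) * X μ : ℤ) : ℂ) * (2 * π))) = 1 := by
    rw [show I * (((∑ μ, ((l μ : ℕ) : ℤ) * X μ : ℤ) : ℂ) * (2 * π)) = ((∑ μ, ((l μ : ℕ) : ℤ) * X μ : ℤ) : ℂ) * (2 * π * I) by ring]
    exact Complex.exp_int_mul_two_pi_mul_I _
  rw [h1, mul_one]

/-- [folklore] row reading: `cphase (N•X + a) (k_l) = cphase a (k_l) · cphase X k`. -/
theorem cphase_chart_aliasPt (N : ℕ) [NeZero N] (X a : Fin (d + 1) → ℤ) (l : Fin (d + 1) → Fin N) (k : Fin (d + 1) → ℂ) :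
    cphase ((N : ℤ) • X + a) (aliasPt N l k) = cphase a (aliasPt N l k) * cphase X k := by
  rw [show cphase ((N : ℤ) • X + a) (aliasPt N l k) = cphase ((N : ℤ) • X) (aliasPt N l k) * cphase a (aliasPt N l k) from pw_add _ _ _,
    cphase_zsmul_aliasPt, mul_comm]

/-- [folklore] column reading: `cphase (−(N•X + a)) (k_l) = cphase (−a) (k_l) · cphase (−X) k`. -/
theorem cphase_neg_chart_aliasPt (N : ℕ) [NeZero N] (X a : Fin (d + 1) → ℤ) (l : Fin (d + 1) → Fin N) (k : Fin (d + 1) → ℂ) :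
    cphase (-((N : ℤ) • X + a)) (aliasPt N l k) = cphase (-a) (aliasPt N l k) * cphase (-X) k := by
  rw [neg_add, ← smul_neg, show cphase ((N : ℤ) • (-X) + -a) (aliasPt N l k) = cphase ((N : ℤ) • (-X)) (aliasPt N l k) * cphase (-a) (aliasPt N l k)
    from pw_add _ _ _, cphase_zsmul_aliasPt, mul_comm]

/-- [folklore] the character at an alias momentum factorises: `cphase z (k_l) = cphase′ z (k/N) · Π_μ e^{i(2πl_μ/N) z_μ}` with the
`l`-free factor `e^{i Σ_μ k_μ z_μ / N}`. -/
theorem cphase_aliasPt_eq (N : ℕ) [NeZero N] (z : Fin (d + 1) → ℤ) (l : Fin (d + 1) → Fin N) (k : Fin (d + 1) → ℂ) :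
    cphase z (aliasPt N l k) = cexp (I * ∑ μ, k μ / N * (z μ : ℂ)) * ∏ μ, cexp (I * (2 * π * ((l μ : ℕ) : ℂ) / N) * (z μ : ℂ)) := by
  unfold cphase
  rw [← Complex.exp_sum, ← Complex.exp_add]
  congr 1
  rw [Finset.mul_sum, Finset.mul_sum, ← Finset.sum_add_distrib]
  refine Finset.sum_congr rfl fun μ _ => ?_
  rw [aliasPt_apply']
  ring

/-- [folklore] **CHARACTER SUM OVER THE ALIAS INDEX**: `Σ_l cphase z (k_l) = N^D · e^{i k·(z/N)}` if `N ∣ z` coordinatewise, else `0`;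
in the divisible case `z = N•w` the value is `N^D · cphase w k`. -/
theorem sum_cphase_aliasPt (N : ℕ) [NeZero N] (z : Fin (d + 1) → ℤ) (k : Fin (d + 1) → ℂ) :
    ∑ l : Fin (d + 1) → Fin N, cphase z (aliasPt N l k)
      = if ∀ μ, (N : ℤ) ∣ z μ then ((N : ℂ) ^ (d + 1)) * cexp (I * ∑ μ, k μ / N * (z μ : ℂ)) else 0 := by
  simp_rw [cphase_aliasPt_eq N z, ← Finset.mul_sum, sum_alias_char N z]
  split_ifs <;> ring

/-- [folklore] the divisible case, read as a coarse character: `Σ_l cphase (N•w) (k_l) = N^D · cphase w k`. -/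
theorem sum_cphase_aliasPt_zsmul (N : ℕ) [NeZero N] (w : Fin (d + 1) → ℤ) (k : Fin (d + 1) → ℂ) :
    ∑ l : Fin (d + 1) → Fin N, cphase ((N : ℤ) • w) (aliasPt N l k) = ((N : ℂ) ^ (d + 1)) * cphase w k := by
  simp_rw [cphase_zsmul_aliasPt N w]
  simp

/-- [folklore] **THE LATTICE-KERNEL SHIFT RULE**: a coarse character in the symbol shifts the kernel argument,
`latticeKernel (G · cphase Z) W = latticeKernel G (W + Z)`. -/
theorem latticeKernel_mul_cphase (G : (Fin (d + 1) → ℂ) → ℂ) (Z W : Fin (d + 1) → ℤ) :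
    latticeKernel (fun k => G k * cphase Z k) W = latticeKernel G (W + Z) := by
  unfold latticeKernel fourierBox
  congr 1
  refine setIntegral_congr_fun measurableSet_Icc fun p _ => ?_
  show G (ofRealVec p) * cphase Z (ofRealVec p) * cexp (I * phase p W) = G (ofRealVec p) * cexp (I * phase p (W + Z))
  rw [GAN24.AliasDecimate.cphase_ofRealVec, B4Green244.phase_add, mul_add, Complex.exp_add]
  ring

/-- [folklore] the shift rule at the origin: `latticeKernel (G · cphase Z) 0 = latticeKernel G Z`. -/
theorem latticeKernel_mul_cphase_zero (G : (Fin (d + 1) → ℂ) → ℂ) (Z : Fin (d + 1) → ℤ) :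
    latticeKernel (fun k => G k * cphase Z k) 0 = latticeKernel G Z := by
  rw [latticeKernel_mul_cphase, zero_add]

/-! ## §3 The block chart of `ℤ^D` with side `N` (blocks `N•X + {0,…,N−1}^D`) and block regrouping of lattice sums -/

section Blocks

variable (N : ℕ) [NeZero N]

/-- [folklore] an offset label as a lattice vector (`= AffineAveraging.toSite (fun μ => c μ)`). -/
def finSite (c : Fin (d + 1) → Fin N) : Fin (d + 1) → ℤ := fun μ => ((c μ : ℕ) : ℤ)

/-- [folklore] the block label (coordinatewise floor division by `N`). -/
def blkN (x : Fin (d + 1) → ℤ) : Fin (d + 1) → ℤ := fun μ => x μ / (N : ℤ)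

/-- [folklore] the intra-block offset (coordinatewise remainder, as an element of `{0,…,N−1}^D`). -/
def locN (x : Fin (d + 1) → ℤ) : Fin (d + 1) → Fin N := fun μ =>
  ⟨(x μ % (N : ℤ)).toNat, by
    have h0 : (0 : ℤ) < N := by exact_mod_cast Nat.pos_of_ne_zero (NeZero.ne N)
    have h1 := Int.emod_lt_of_pos (x μ) h0
    have h2 := Int.emod_nonneg (x μ) h0.ne'
    omega⟩

/-- [folklore] Euclidean division: `N • blkN x + finSite (locN x) = x`. -/
theorem chart_blkN_locN (x : Fin (d + 1) → ℤ) : (N : ℤ) • blkN N x + finSite N (locN N x) = x := by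
  funext μ
  have h0 : (0 : ℤ) < N := by exact_mod_cast Nat.pos_of_ne_zero (NeZero.ne N)
  simp only [Pi.add_apply, Pi.smul_apply, smul_eq_mul, blkN, locN, finSite, Int.toNat_of_nonneg (Int.emod_nonneg (x μ) h0.ne')]
  exact Int.mul_ediv_add_emod (x μ) N

/-- [folklore] `blkN (N•X + finSite c) = X`. -/
theorem blkN_chart (X : Fin (d + 1) → ℤ) (c : Fin (d + 1) → Fin N) : blkN N ((N : ℤ) • X + finSite N c) = X := by
  funext μ
  have h0 : (0 : ℤ) < N := by exact_mod_cast Nat.pos_of_ne_zero (NeZero.ne N)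
  have hc0 : (0 : ℤ) ≤ ((c μ : ℕ) : ℤ) := by positivity
  have hc1 : ((c μ : ℕ) : ℤ) < N := by exact_mod_cast (c μ).isLt
  simp only [blkN, Pi.add_apply, Pi.smul_apply, smul_eq_mul, finSite]
  rw [add_comm, Int.add_mul_ediv_left _ _ h0.ne', Int.ediv_eq_zero_of_lt hc0 hc1, zero_add]

/-- [folklore] `locN (N•X + finSite c) = c`. -/
theorem locN_chart (X : Fin (d + 1) → ℤ) (c : Fin (d + 1) → Fin N) : locN N ((N : ℤ) • X + finSite N c) = c := by
  funext μ
  have h0 : (0 : ℤ) < N := by exact_mod_cast Nat.pos_of_ne_zero (NeZero.ne N)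
  have hc0 : (0 : ℤ) ≤ ((c μ : ℕ) : ℤ) := by positivity
  have hc1 : ((c μ : ℕ) : ℤ) < N := by exact_mod_cast (c μ).isLt
  apply Fin.ext
  simp only [locN, Pi.add_apply, Pi.smul_apply, smul_eq_mul, finSite]
  rw [add_comm, Int.add_mul_emod_self_left, Int.emod_eq_of_lt hc0 hc1, Int.toNat_natCast]

/-- [folklore] **THE BLOCK CHART** `ℤ^D × {0,…,N−1}^D ≃ ℤ^D`, `(X, c) ↦ N•X + c`. -/
def blockEquivN : (Fin (d + 1) → ℤ) × (Fin (d + 1) → Fin N) ≃ (Fin (d + 1) → ℤ) where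
  toFun p := (N : ℤ) • p.1 + finSite N p.2
  invFun x := (blkN N x, locN N x)
  left_inv p := by
    rcases p with ⟨X, c⟩
    simp only [blkN_chart, locN_chart]
  right_inv x := chart_blkN_locN N x

/-- [folklore] **BLOCK REGROUPING** of an absolutely convergent lattice sum (complex-valued):
`Σ'_x f x = Σ'_X Σ_{c ∈ {0,…,N−1}^D} f (N•X + c)`. -/
theorem tsum_blocksN {f : (Fin (d + 1) → ℤ) → ℂ} (hf : Summable f) :
    ∑' x, f x = ∑' X : Fin (d + 1) → ℤ, ∑ c : Fin (d + 1) → Fin N, f ((N : ℤ) • X + finSite N c) := by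
  have hf' : Summable (f ∘ ⇑(blockEquivN (d := d) N)) := (blockEquivN N).summable_iff.mpr hf
  rw [← (blockEquivN (d := d) N).tsum_eq f]
  rw [show (∑' p, f ((blockEquivN (d := d) N) p)) = ∑' p, (f ∘ ⇑(blockEquivN (d := d) N)) p from rfl,
    hf'.tsum_prod' (fun X => hf'.prod_factor X)]
  refine tsum_congr fun X => ?_
  rw [tsum_fintype]
  rfl

omit [NeZero N] in
/-- [folklore] the offset vector of a `Fin`-label is `toSite` of its values: `finSite c = toSite (fun μ => c μ)`. -/
theorem finSite_eq_toSite (c : Fin (d + 1) → Fin N) : finSite N c = toSite (fun μ => (c μ : ℕ)) := rfl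

end Blocks

end Summit.QuantumFields.BalabanUV.Beta.FP.SliceProjectorBlochChart

end
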